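import Literature.NumberTheory.Transcendental.KZLogCalculusProofs
import Literature.ModelTheory.ExponentialFields.SemialgebraicComponents

/-!
# `LogPrimitiveNL` (stmt-KontsevichZagierPeriods-2836), line `logderiv-peeling`, stub `stub_descent` —
part 1: cells bookkeeping

Helpers for the Kolchin–Ostrowski descent (lead's stub): reindexing finite families of cells by
`Fin N`, the common smooth locus of finitely many `ℚ`-semialgebraic functions (co-null, open,
`ℚ`-semialgebraic), the decomposition of an open `ℚ`-semialgebraic set into its finitely many
connected components (open, `ℚ`-semialgebraic, preconnected, pairwise disjoint), and rational points
of open sets. Everything is folklore real semialgebraic geometry on top of the tree's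
`KZ.exists_isOpen_contDiffOn`, `IsSemialgebraic.finite_setOf_connectedComponentIn`,
`IsSemialgebraic.isSemialgebraic_connectedComponentIn`.
-/

noncomputable section

open Set MeasureTheory
open scoped ContDiff
open Literature.NumberTheory.Transcendental Literature.ModelTheory.ExponentialFields

namespace Summit.KontsevichZagierPeriods.LiouvilleUnfolding.LogPrimitiveNL

/-- Reindexing a finite family of sets by `Fin N` (via `Fintype.equivFin`): the new family has the
same members, the same union, and inherits pairwise disjointness. [folklore] -/
theorem descent_reindex_fin {X ι : Type*} [Fintype ι] (C : ι → Set X) :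
    ∃ (N : ℕ) (e : ι ≃ Fin N), (⋃ c, C (e.symm c)) = ⋃ i, C i ∧
      (Pairwise (Function.onFun Disjoint C) →
        Pairwise (Function.onFun Disjoint (fun c => C (e.symm c)))) := by
  refine ⟨Fintype.card ι, Fintype.equivFin ι, ?_, fun hd => ?_⟩
  · ext x
    simp only [mem_iUnion]
    constructor
    · rintro ⟨c, hc⟩
      exact ⟨_, hc⟩
    · rintro ⟨i, hi⟩
      exact ⟨Fintype.equivFin ι i, by simpa using hi⟩
  · intro c c' hcc'
    exact hd ((Fintype.equivFin ι).symm.injective.ne hcc')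

/-- The difference `U \ interior U` of a `ℚ`-semialgebraic set is Lebesgue-null (it lies in the
frontier, which is null: `volume_frontier_eq_zero_of_isSemialgebraic`). [folklore] -/
theorem descent_volume_diff_interior {n : ℕ} {U : Set (Fin n → ℝ)} (hU : IsSemialgebraic ℚ U) :
    volume (U \ interior U) = 0 :=
  measure_mono_null (show U \ interior U ⊆ frontier U from fun _ hx => ⟨subset_closure hx.1, hx.2⟩)
    (volume_frontier_eq_zero_of_isSemialgebraic hU)

/-- **Common smooth locus of finitely many semialgebraic functions.** For `ℚ`-semialgebraic
functions `F₀, …, F_{M-1}` on a `ℚ`-semialgebraic `U ⊆ ℝⁿ` there is an open `ℚ`-semialgebraic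
`U₁ ⊆ U` with `U \ U₁` null on which every `Fₘ` is `C^∞` (iterate `KZ.exists_isOpen_contDiffOn`).
[folklore] -/
theorem descent_smooth_locus {n : ℕ} {U : Set (Fin n → ℝ)} (hU : IsSemialgebraic ℚ U) :
    ∀ (M : ℕ) (F : Fin M → (Fin n → ℝ) → ℝ), (∀ m, IsSemialgebraicFunOn ℚ U (F m)) →
      ∃ U₁ : Set (Fin n → ℝ), U₁ ⊆ U ∧ IsOpen U₁ ∧ IsSemialgebraic ℚ U₁ ∧ volume (U \ U₁) = 0 ∧
        ∀ m, ContDiffOn ℝ ∞ (F m) U₁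
  | 0, _, _ => by
    exact ⟨interior U, interior_subset, isOpen_interior, isSemialgebraic_interior hU,
      descent_volume_diff_interior hU, fun m => m.elim0⟩
  | M + 1, F, hF => by
    obtain ⟨U₁, hU₁U, hU₁o, hU₁s, hU₁null, hsmooth⟩ :=
      descent_smooth_locus hU M (fun m => F (Fin.castSucc m)) fun m => hF _
    obtain ⟨G, hGU₁, hGo, hGs, hGsmooth, -, hGnull⟩ :=
      KZ.exists_isOpen_contDiffOn hU₁s ((hF (Fin.last M)).mono hU₁U hU₁s)
    refine ⟨G, hGU₁.trans hU₁U, hGo, hGs, ?_, fun m => ?_⟩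
    · refine measure_mono_null (fun x hx => ?_) (measure_union_null hU₁null hGnull)
      by_cases hx1 : x ∈ U₁
      · exact Or.inr ⟨hx1, hx.2⟩
      · exact Or.inl ⟨hx.1, hx1⟩
    · refine Fin.lastCases ?_ (fun i => ?_) m
      · exact hGsmooth
      · exact (hsmooth i).mono hGU₁

/-- **Connected components of an open semialgebraic set, as a finite family of cells.** An open
`ℚ`-semialgebraic `U ⊆ ℝⁿ` is the disjoint union of finitely many open, preconnected, nonempty,
`ℚ`-semialgebraic sets (its connected components:
`IsSemialgebraic.finite_setOf_connectedComponentIn`, `IsSemialgebraic.isSemialgebraic_connectedComponentIn`,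
`IsOpen.connectedComponentIn`). [folklore] -/
theorem descent_components {n : ℕ} {U : Set (Fin n → ℝ)} (hU : IsSemialgebraic ℚ U) (hUo : IsOpen U) :
    ∃ (N : ℕ) (C : Fin N → Set (Fin n → ℝ)),
      (∀ c, IsSemialgebraic ℚ (C c) ∧ IsOpen (C c) ∧ IsPreconnected (C c) ∧ (C c).Nonempty ∧
        C c ⊆ U) ∧
      Pairwise (Function.onFun Disjoint C) ∧ (⋃ c, C c) = U := by
  classical
  set S : Set (Set (Fin n → ℝ)) := {K | ∃ x ∈ U, K = connectedComponentIn U x} with hS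
  have hSfin : S.Finite := hU.finite_setOf_connectedComponentIn
  haveI : Fintype S := hSfin.fintype
  -- the family indexed by the finite type `S`
  have hmem : ∀ K : S, ∃ x ∈ U, (K : Set (Fin n → ℝ)) = connectedComponentIn U x := fun K => K.2
  obtain ⟨N, e, hunion, hdisj⟩ := descent_reindex_fin (fun K : S => (K : Set (Fin n → ℝ)))
  refine ⟨N, fun c => ((e.symm c : S) : Set (Fin n → ℝ)), fun c => ?_, hdisj ?_, ?_⟩
  · obtain ⟨x, hx, hK⟩ := hmem (e.symm c)
    dsimp only
    rw [hK]
    exact ⟨hU.isSemialgebraic_connectedComponentIn x, hUo.connectedComponentIn,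
      isPreconnected_connectedComponentIn, ⟨x, mem_connectedComponentIn hx⟩,
      connectedComponentIn_subset U x⟩
  · intro K K' hKK'
    obtain ⟨x, hx, hK⟩ := hmem K
    obtain ⟨x', hx', hK'⟩ := hmem K'
    rw [Function.onFun, hK, hK', Set.disjoint_iff]
    rintro z ⟨hz, hz'⟩
    apply hKK'
    apply Subtype.ext
    rw [hK, hK', connectedComponentIn_eq hz, connectedComponentIn_eq hz']
  · rw [hunion]
    apply Subset.antisymm
    · exact iUnion_subset fun K => by
        obtain ⟨x, hx, hK⟩ := hmem K
        rw [hK]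
        exact connectedComponentIn_subset U x
    · intro x hx
      exact mem_iUnion.2 ⟨⟨connectedComponentIn U x, x, hx, rfl⟩, mem_connectedComponentIn hx⟩

/-- A nonempty open subset of `ℝⁿ` contains a point with rational coordinates. [folklore] -/
theorem descent_exists_ratCast_mem {n : ℕ} {U : Set (Fin n → ℝ)} (hUo : IsOpen U) {x : Fin n → ℝ}
    (hx : x ∈ U) : ∃ q : Fin n → ℚ, (fun i => (q i : ℝ)) ∈ U := by
  obtain ⟨ε, hε, hball⟩ := Metric.isOpen_iff.1 hUo x hx
  have hq : ∀ i, ∃ q : ℚ, dist (q : ℝ) (x i) < ε := fun i => by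
    obtain ⟨q, hq1, hq2⟩ := exists_rat_btwn (show x i - ε < x i + ε by linarith)
    refine ⟨q, ?_⟩
    rw [Real.dist_eq, abs_lt]
    constructor <;> linarith
  choose q hq using hq
  refine ⟨q, hball ?_⟩
  rw [Metric.mem_ball, dist_pi_lt_iff hε]
  exact hq

/-- A linear map on `ℝⁿ` vanishing on every coordinate vector `Pi.single j 1` is zero; hence a
Fréchet derivative all of whose partials vanish is zero. [folklore] -/
theorem descent_clm_eq_zero_of_apply_single {n : ℕ} (L : (Fin n → ℝ) →L[ℝ] ℝ)
    (h : ∀ j : Fin n, L (Pi.single j (1 : ℝ)) = 0) : L = 0 := by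
  apply ContinuousLinearMap.coe_injective
  refine LinearMap.pi_ext fun j t => ?_
  have : (Pi.single j t : Fin n → ℝ) = t • (Pi.single j (1 : ℝ) : Fin n → ℝ) := by
    rw [← Pi.single_smul, smul_eq_mul, mul_one]
  simp [this, h j]

/-- **Integrating a zero gradient back on a preconnected open set**: a function differentiable on
an open preconnected `C` all of whose partial derivatives vanish on `C` is constant on `C`
(`IsOpen.is_const_of_fderiv_eq_zero`). [folklore] -/
theorem descent_const_of_partials_eq_zero {n : ℕ} {C : Set (Fin n → ℝ)} (hCo : IsOpen C)
    (hCc : IsPreconnected C) {F : (Fin n → ℝ) → ℝ} (hF : DifferentiableOn ℝ F C)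
    (h0 : ∀ j : Fin n, ∀ x ∈ C, fderiv ℝ F x (Pi.single j (1 : ℝ)) = 0) {x y : Fin n → ℝ}
    (hx : x ∈ C) (hy : y ∈ C) : F x = F y :=
  hCo.is_const_of_fderiv_eq_zero hCc hF
    (fun z hz => descent_clm_eq_zero_of_apply_single _ fun j => h0 j z hz) hx hy

/-- **Cells of an open semialgebraic set** (registered form of `descent_components`, consumed by the
integrate-back step of `stub_descent`): an open `ℚ`-semialgebraic `U ⊆ ℝⁿ` is the disjoint union of
finitely many open, preconnected, nonempty `ℚ`-semialgebraic cells. [folklore] -/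
theorem descent_cells : ∀ (n : ℕ) (U : Set (Fin n → ℝ)), IsSemialgebraic ℚ U → IsOpen U →
    ∃ (N : ℕ) (C : Fin N → Set (Fin n → ℝ)),
      (∀ c, IsSemialgebraic ℚ (C c) ∧ IsOpen (C c) ∧ IsPreconnected (C c) ∧ (C c).Nonempty ∧
        C c ⊆ U) ∧
      Pairwise (Function.onFun Disjoint C) ∧ (⋃ c, C c) = U :=
  fun _ _ hU hUo => descent_components hU hUo

end Summit.KontsevichZagierPeriods.LiouvilleUnfolding.LogPrimitiveNL

end
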